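import Summits.ResolutionOfSingularities.ResolutionOfSingularities.Theorems.PurelyInseparableDim4ResConeWeightLedgerSocket
import Summits.ResolutionOfSingularities.ResolutionOfSingularities.Theorems.PurelyInseparableDim4ResConeHeavyPermanentSet
import HarnessLib
import HarnessLib.Audit.Tags

/-!
# Purely inseparable four-folds — THE WEIGHT LEDGER WITH A PERMANENCE MONITOR: every tail has a FROZEN SET (letters never charted nor
# translated from some time on, the others hit beyond every index); a `decide`-checked certificate then confines the tail to a LIVE level of a
# frozen-set-indexed potential — the kernel form of the «residue ledger» (frozen light monomial × active game), every prime `p`, every shade `d`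
# (cell `res-dim4-pi`, K2(p) lane, rung-1 generic brick FILE 3; seat res-dim4-p-8 g6)

[OURS · counted 0 · cell `res-dim4-pi` · K2(p) lane (holder res-dim4-p-12 g5: g5-2 (5), RUNG-0 EXIT LINE «kernel ledger p-8: the residue SCC
certificates … ONE file per (7, d)», DATUM l.5842 K-twinned l.5867) · seat res-dim4-p-8 g6.]  **HONEST LABEL.**  BOOKKEEPING about OUR MODEL
(`Step0 p` chains with cleaning on presented states of `z^p + F(x₁..x₄)`, ISOLATED regime).  Nothing here proves any TAIL(p, d, e), K2(p),
`NoIsolatedTrap p p`, CJS 6.40 or resolution of singularities in dimension ≥ 4 / characteristic `p` — NOT proved.  AI kernel work.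

* §1 **`exists_frozen_monitor`** (pure logic on a witnessed chain): flags `P : Fin 4 → Bool` and a time `k₁ ≥ k₀` with every `P`-letter never
  charted nor translated after `k₁` and every non-`P` letter charted or translated beyond every index.
* §2 Boolean kit on `(P, a)`: `pcount` (S₄-invariant counts of (weight, flag) pairs, the key of the generated tables), `permcode` (an invariant
  code of the frozen weights, constant along `P`-keeping edges), `permWeight` (`= Σ_{P z} a z`, `permWeight_eq_sum`), `keepsB P jj S` (the edge
  keeps every `P`-letter and charts none), `hasFreeWB` / `hitsWB` (a non-frozen letter of weight `w` exists / is hit by the edge), and the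
  admissibility filters `okAll` (none) and `okTwo` («at most two active letters outside `P`», to be discharged by res-dim4-p-5's
  `good_modulo_frozen` when it lands — NOT used by any theorem here); `strip3` (verdict tables for arbitrary `e_G` avoid the C13 code `3`).
* §3 **`ledgerCheckPermAt p d ok h v P : Bool`** — at the frozen set `P`, for every legal `ok`-state `a`: verdict bound `v ≤ p + 3`; `1` ⇒ not lower-band;
  `4` ⇒ `p ≤ d + permWeight P a` (HEAVY); `5 + w` ⇒ a non-frozen letter of weight `w` exists; and for every `P`-keeping edge to a legal
  `ok`-child `b`: `h P b ≤ h P a`; `3` & same level ⇒ not lossy; `5 + w` & same level ⇒ no non-frozen weight-`w` letter is hit; `2` & same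
  level ⇒ no `P`-keeping legal `ok`-grandchild of the same level by another chart keeps the first newborn (no satellite 2-path) — and
  **`sound_of_ledgerCheckPermAt`**.
* §4 **`tail_confined_of_ledgerCheckPerm`** (`d < p`, `e_G ≡ 2`): given `∀ P, ledgerCheckPermAt p d ok h v P = true` (sixteen `decide`s via
  FILE 1's `forall_flags_of_forall_bool4`) and the admissibility of `ok` along
  the tail for the monitor's `P` (`hok`; trivial for `okAll`: `okAll_admissible`), every witnessed isolated above-floor constant-`(d, e_G = 2)`
  tail admits `P, i, k₂` with `v i = 0`, `∀ k ≥ k₂, Legal p d r_k ∧ ok P r_k ∧ h P r_k = i`, the `P`-letters frozen from `k₂` and the others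
  hit beyond every index.  Verdict `4` is res-dim4-p-5 g5's `no_tail_of_permanent_weight_ge` (p712052) by name; `1`/`2`/`3` are the DOCK /
  FT / C13 of FILE 1; `5 + w` is the monitor itself (a hit of a kept-so-far letter of weight `w` happens inside the level).
At `p = 7` the generated certificates (HOME `res-dim4-p-8/g6/permcert.py`, kernel-timed: `(7,4)` in 159 s) print the holder's residue
rows R4a–c / R3a–c once `ok := okTwo` is admissible; with `okAll` they print the frozen-monomial zoos of DATUM l.5829.
[cite: CossartJannsenSaito2020, Thm. 3.14] bears_on: LADDER-RESOLUTION:D157-DOOR2 (res-dim4-pi · K2(p) · weight ledger with permanence monitor).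
Supports stmt-ResolutionOfSingularities-16155 (helper).
-/

set_option linter.dupNamespace false -- mandated namespace of this single-conjunct summit

noncomputable section

namespace Summit.ResolutionOfSingularities.ResolutionOfSingularities.Theorems.PIDim4

namespace ResCone

open MvPolynomial Finset Literature.AlgebraicGeometry.Resolution
open Literature.AlgebraicGeometry.Resolution.CentreBlowup Literature.AlgebraicGeometry.Resolution.Hauser2010

/-! ## 1. The frozen-set monitor of a witnessed chain -/

/-- **EVERY WITNESSED CHAIN HAS A FROZEN SET**: flags `P` and a time `k₁ ≥ k₀` such that every `P`-letter is never charted nor translated from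
`k₁` on, and every other letter is charted or translated beyond every index (pure logic: a letter is hit finitely or infinitely often). [folklore] -/
theorem exists_frozen_monitor {K : Type} [Field K] (j : ℕ → Fin 4) (b : ℕ → Fin 4 → K) (k₀ : ℕ) :
    ∃ (P : Fin 4 → Bool) (k₁ : ℕ), k₀ ≤ k₁ ∧ (∀ k, k₁ ≤ k → ∀ z, P z = true → j k ≠ z ∧ b k z = 0) ∧
      (∀ z, P z = false → ∀ k₂, ∃ k, k₂ ≤ k ∧ (j k = z ∨ b k z ≠ 0)) := by
  classical
  let Q : Fin 4 → Prop := fun z => ∃ t, ∀ k, t ≤ k → j k ≠ z ∧ b k z = 0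
  have ht : ∀ z, ∃ t, Q z → ∀ k, t ≤ k → j k ≠ z ∧ b k z = 0 := fun z => by
    by_cases hq : Q z
    · obtain ⟨t, ht⟩ := hq; exact ⟨t, fun _ => ht⟩
    · exact ⟨0, fun h => absurd h hq⟩
  choose t ht using ht
  refine ⟨fun z => decide (Q z), k₀ + ∑ z, t z, by omega, fun k hk z hz => ?_, fun z hz k₂ => ?_⟩
  · have hQ : Q z := of_decide_eq_true hz
    have htz : t z ≤ ∑ i, t i := Finset.single_le_sum (fun i _ => Nat.zero_le (t i)) (Finset.mem_univ z)
    exact ht z hQ k (by omega)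
  · have hQ : ¬ Q z := fun h => by simp [h] at hz
    by_contra hno
    push Not at hno
    exact hQ ⟨k₂, fun k hk => hno k hk⟩

namespace WeightLedger

/-! ## 2. The Boolean kit on (frozen flags, weights) -/

/-- Number of letters of weight `w` whose frozen-flag is `f` — the S₄-invariant key of the generated sub-index tables. [OURS · bookkeeping] -/
abbrev pcount (P : Fin 4 → Bool) (a : Fin 4 → ℕ) (w : ℕ) (f : Bool) : ℕ :=
  (if a 0 = w ∧ P 0 = f then 1 else 0) + (if a 1 = w ∧ P 1 = f then 1 else 0) +
  (if a 2 = w ∧ P 2 = f then 1 else 0) + (if a 3 = w ∧ P 3 = f then 1 else 0)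

/-- An S₄-invariant code of the multiset of frozen weights (constant along `P`-keeping edges). [OURS · bookkeeping] -/
abbrev permcode (P : Fin 4 → Bool) (a : Fin 4 → ℕ) : ℕ :=
  (if P 0 then 5 ^ a 0 else 0) + (if P 1 then 5 ^ a 1 else 0) + (if P 2 then 5 ^ a 2 else 0) + (if P 3 then 5 ^ a 3 else 0)

/-- The frozen weight `Σ_{P z} a z`. [OURS · bookkeeping] -/
abbrev permWeight (P : Fin 4 → Bool) (a : Fin 4 → ℕ) : ℕ :=
  (if P 0 then a 0 else 0) + (if P 1 then a 1 else 0) + (if P 2 then a 2 else 0) + (if P 3 then a 3 else 0)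

/-- `permWeight` is the sum of the weights over the frozen letters. [folklore] -/
theorem permWeight_eq_sum (P : Fin 4 → Bool) (a : Fin 4 → ℕ) :
    permWeight P a = ∑ z ∈ Finset.univ.filter (fun z => P z = true), a z := by
  rw [Finset.sum_filter, Fin.sum_univ_four]

/-- The edge (chart `jj`, kept flags `S`) charts no frozen letter and keeps every frozen letter. [OURS · bookkeeping] -/
def keepsB (P : Fin 4 → Bool) (jj : Fin 4) (S : Fin 4 → Bool) : Bool :=
  !P jj && (!P 0 || S 0) && (!P 1 || S 1) && (!P 2 || S 2) && (!P 3 || S 3)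

/-- `keepsB` read as a proposition. [folklore] -/
theorem keepsB_eq_true_iff (P : Fin 4 → Bool) (jj : Fin 4) (S : Fin 4 → Bool) :
    keepsB P jj S = true ↔ (P jj = false ∧ ∀ z, P z = true → S z = true) := by
  simp only [keepsB, Bool.and_eq_true, Bool.or_eq_true, Bool.not_eq_true']
  constructor
  · rintro ⟨⟨⟨⟨hj, h0⟩, h1⟩, h2⟩, h3⟩
    refine ⟨hj, fun z hz => ?_⟩
    fin_cases z <;> simp at hz <;> simp_all
  · rintro ⟨hj, hall⟩
    refine ⟨⟨⟨⟨hj, ?_⟩, ?_⟩, ?_⟩, ?_⟩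
    · cases hP : P 0
      · exact Or.inl rfl
      · exact Or.inr (hall 0 hP)
    · cases hP : P 1
      · exact Or.inl rfl
      · exact Or.inr (hall 1 hP)
    · cases hP : P 2
      · exact Or.inl rfl
      · exact Or.inr (hall 2 hP)
    · cases hP : P 3
      · exact Or.inl rfl
      · exact Or.inr (hall 3 hP)

/-- Some non-frozen letter has weight `w`. [OURS · bookkeeping] -/
def hasFreeWB (P : Fin 4 → Bool) (a : Fin 4 → ℕ) (w : ℕ) : Bool :=
  (!P 0 && decide (a 0 = w)) || (!P 1 && decide (a 1 = w)) || (!P 2 && decide (a 2 = w)) || (!P 3 && decide (a 3 = w))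

/-- `hasFreeWB` read as a proposition. [folklore] -/
theorem hasFreeWB_eq_true_iff (P : Fin 4 → Bool) (a : Fin 4 → ℕ) (w : ℕ) :
    hasFreeWB P a w = true ↔ ∃ z, P z = false ∧ a z = w := by
  simp only [hasFreeWB, Bool.or_eq_true, Bool.and_eq_true, Bool.not_eq_true', decide_eq_true_eq]
  constructor
  · rintro (((h | h) | h) | h)
    exacts [⟨0, h⟩, ⟨1, h⟩, ⟨2, h⟩, ⟨3, h⟩]
  · rintro ⟨z, hz⟩
    fin_cases z <;> simp at hz <;> tauto

/-- The edge (chart `jj`, kept flags `S`) hits (charts or translates) a non-frozen letter of weight `w`. [OURS · bookkeeping] -/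
def hitsWB (P : Fin 4 → Bool) (a : Fin 4 → ℕ) (w : ℕ) (jj : Fin 4) (S : Fin 4 → Bool) : Bool :=
  (!P 0 && decide (a 0 = w) && (decide (jj = 0) || !S 0)) || (!P 1 && decide (a 1 = w) && (decide (jj = 1) || !S 1)) ||
  (!P 2 && decide (a 2 = w) && (decide (jj = 2) || !S 2)) || (!P 3 && decide (a 3 = w) && (decide (jj = 3) || !S 3))

/-- A hit of a specific non-frozen letter of weight `w` makes `hitsWB` true. [folklore] -/
theorem hitsWB_eq_true_of (P : Fin 4 → Bool) (a : Fin 4 → ℕ) (w : ℕ) (jj : Fin 4) (S : Fin 4 → Bool) {z : Fin 4}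
    (hP : P z = false) (ha : a z = w) (hhit : jj = z ∨ S z = false) : hitsWB P a w jj S = true := by
  fin_cases z <;> simp only [hitsWB, Bool.or_eq_true, Bool.and_eq_true, Bool.not_eq_true', decide_eq_true_eq] <;> simp_all

/-- No admissibility filter. [OURS · bookkeeping] -/
def okAll (_ : Fin 4 → Bool) (_ : Fin 4 → ℕ) : Bool := true

/-- «At most two active (non-frozen, positive-weight) letters» — the admissibility filter res-dim4-p-5's `good_modulo_frozen` supplies (not used by
any theorem of this file). [OURS · bookkeeping] -/
def okTwo (P : Fin 4 → Bool) (a : Fin 4 → ℕ) : Bool :=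
  decide ((if !P 0 && decide (1 ≤ a 0) then 1 else 0) + (if !P 1 && decide (1 ≤ a 1) then 1 else 0) +
    (if !P 2 && decide (1 ≤ a 2) then 1 else 0) + (if !P 3 && decide (1 ≤ a 3) then 1 else 0) ≤ 2)

/-- Replace the verdict `3` by `0`: certificates meant for ARBITRARY `e_G` (power cones) must not use the C13 verdict, and wrapping a table in
`strip3` makes that evident to the kernel (`strip3_ne_three`). [OURS · bookkeeping] -/
def strip3 (n : ℕ) : ℕ := if n = 3 then 0 else n

/-- `strip3 n ≠ 3`. [folklore] -/
theorem strip3_ne_three (n : ℕ) : strip3 n ≠ 3 := by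
  unfold strip3; split_ifs <;> omega

/-! ## 3. The frozen-set certificate checker and its soundness -/

/-- **THE CERTIFICATE CHECKER AT ONE FROZEN SET `P`** (see the module docstring); a certificate is checked by the sixteen instances
`P = ![s0, s1, s2, s3]` (one `decide +kernel` each). Kernel-reducible. [OURS · bookkeeping] -/
def ledgerCheckPermAt (p d : ℕ) (ok : (Fin 4 → Bool) → (Fin 4 → ℕ) → Bool)
    (h : (Fin 4 → Bool) → (Fin 4 → ℕ) → ℕ) (v : ℕ → ℕ) (P : Fin 4 → Bool) : Bool :=
  (vecs p).all fun a => !legalB p d a || !ok P a || (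
    decide (v (h P a) ≤ p + 3) &&
    (!decide (v (h P a) = 1) || !decide (LowerBand p d a)) &&
    (!decide (v (h P a) = 4) || decide (p ≤ d + permWeight P a)) &&
    (!decide (5 ≤ v (h P a)) || hasFreeWB P a (v (h P a) - 5)) &&
    (charts.all fun jj => flags.all fun S => !keepsB P jj S || !legalB p d (child p d a jj S) || !ok P (child p d a jj S) || (
        decide (h P (child p d a jj S) ≤ h P a) &&
        (!decide (v (h P a) = 3) || !decide (h P (child p d a jj S) = h P a) || !lossyB a (child p d a jj S)) &&
        (!decide (5 ≤ v (h P a)) || !decide (h P (child p d a jj S) = h P a) || !hitsWB P a (v (h P a) - 5) jj S) &&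
        (!decide (v (h P a) = 2) || !decide (h P (child p d a jj S) = h P a) ||
          (charts.all fun jj' => flags.all fun S' => !keepsB P jj' S' ||
            !legalB p d (child p d (child p d a jj S) jj' S') || !ok P (child p d (child p d a jj S) jj' S') ||
            !decide (h P (child p d (child p d a jj S) jj' S') = h P a) || decide (jj' = jj) ||
            decide (child p d (child p d a jj S) jj' S' jj = 0))))))

/-- **SOUNDNESS OF THE FROZEN-SET CHECKER**: the finite facts a tail confined to a level contradicts (state clauses, edge clauses, 2-path clause).
[OURS] [folklore] -/
theorem sound_of_ledgerCheckPermAt {p d : ℕ} {ok : (Fin 4 → Bool) → (Fin 4 → ℕ) → Bool} {h : (Fin 4 → Bool) → (Fin 4 → ℕ) → ℕ}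
    {v : ℕ → ℕ} {P : Fin 4 → Bool} (H : ledgerCheckPermAt p d ok h v P = true) (a : Fin 4 → ℕ) (ha : Legal p d a)
    (hok : ok P a = true) :
    (v (h P a) ≤ p + 3 ∧ (v (h P a) = 1 → ¬ LowerBand p d a) ∧ (v (h P a) = 4 → p ≤ d + permWeight P a) ∧
      (5 ≤ v (h P a) → hasFreeWB P a (v (h P a) - 5) = true)) ∧
    ∀ (jj : Fin 4) (S : Fin 4 → Bool), keepsB P jj S = true → Legal p d (child p d a jj S) → ok P (child p d a jj S) = true →
      h P (child p d a jj S) ≤ h P a ∧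
      (v (h P a) = 3 → h P (child p d a jj S) = h P a → ¬ Lossy a (child p d a jj S)) ∧
      (5 ≤ v (h P a) → h P (child p d a jj S) = h P a → hitsWB P a (v (h P a) - 5) jj S = false) ∧
      (v (h P a) = 2 → h P (child p d a jj S) = h P a → ∀ (jj' : Fin 4) (S' : Fin 4 → Bool), keepsB P jj' S' = true →
        Legal p d (child p d (child p d a jj S) jj' S') → ok P (child p d (child p d a jj S) jj' S') = true →
        h P (child p d (child p d a jj S) jj' S') = h P a → jj' ≠ jj → child p d (child p d a jj S) jj' S' jj = 0) := by
  simp only [ledgerCheckPermAt, List.all_eq_true, Bool.or_eq_true, Bool.and_eq_true, Bool.not_eq_true',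
    decide_eq_true_eq, ← Bool.not_eq_true, legalB_eq_true_iff, lossyB_eq_true_iff] at H
  rcases H a (mem_vecs_of_legal ha) with (hna | hno) | ⟨⟨⟨⟨hv, hLB⟩, hHV⟩, hFR⟩, hE⟩
  · exact absurd ha hna
  · exact absurd hok hno
  refine ⟨⟨hv, fun h1 => hLB.resolve_left (not_not_intro h1), fun h4 => hHV.resolve_left (not_not_intro h4),
    fun h5 => hFR.resolve_left (not_not_intro h5)⟩, fun jj S hkeep hb hokb => ?_⟩
  rcases hE jj (mem_charts jj) S (mem_flags S) with ((hk | hl) | ho) | ⟨⟨⟨hm, hL⟩, hF⟩, hS⟩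
  · exact absurd hkeep hk
  · exact absurd hb hl
  · exact absurd hokb ho
  refine ⟨hm, fun h3 hs => hL.resolve_left fun h' => h'.elim (· h3) (· hs),
    fun h5 hs => Bool.eq_false_iff.mpr (hF.resolve_left fun h' => h'.elim (· h5) (· hs)), fun h2 hs jj' S' hk' hc hokc hhc hjj => ?_⟩
  have h4 := (hS.resolve_left fun h' => h'.elim (· h2) (· hs)) jj' (mem_charts jj') S' (mem_flags S')
  rcases h4 with ((((h4 | h4) | h4) | h4) | h4) | h4
  exacts [absurd hk' h4, absurd hc h4, absurd hokc h4, absurd hhc h4, absurd h4 hjj, h4]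

end WeightLedger

open WeightLedger

/-! ## 4. The socket with a frozen set -/

section Chain

variable {K : Type} [Field K] (p : ℕ) [Fact p.Prime] [CharP K p] [DecidableEq K]
  {c : ℕ → State K} {j : ℕ → Fin 4} {b : ℕ → Fin 4 → K}

omit [Fact p.Prime] [CharP K p] [DecidableEq K] in
/-- The admissibility hypothesis of a filter `ok` along a chain: for every frozen set the monitor may produce, `ok` holds from some time on.
`okAll` is always admissible. [OURS · bookkeeping] -/
theorem okAll_admissible (k₀ : ℕ) : ∀ (P : Fin 4 → Bool) (k₁ : ℕ), k₀ ≤ k₁ →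
    (∀ k, k₁ ≤ k → ∀ z, P z = true → j k ≠ z ∧ b k z = 0) → (∀ z, P z = false → ∀ k₂, ∃ k, k₂ ≤ k ∧ (j k = z ∨ b k z ≠ 0)) →
    ∃ k₂, k₁ ≤ k₂ ∧ ∀ k, k₂ ≤ k → okAll P ⇑(c k).r = true :=
  fun _ k₁ _ _ _ => ⟨k₁, le_rfl, fun _ _ => rfl⟩

/-- **THE FROZEN-SET CONFINEMENT CORE** (every prime `p`, every shade `d`, any `e_G`): from `∀ P, ledgerCheckPermAt p d ok h v P = true` and the
admissibility of `ok`, a constant-shade-`d` tail has a frozen set `P`, a level `i` and a time `k₂` as in `tail_confined_of_ledgerCheckPerm`, and the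
verdict of `i` is neither `1` (DOCK), `2` (FT), `4` (res-dim4-p-5's `no_tail_of_permanent_weight_ge`) nor `5 + w` (the monitor); if it is `3` then no
late edge is lossy (for C13 to contradict when `e_G ≡ 2`). [OURS] [cite: CossartJannsenSaito2020, Thm. 3.14] -/
theorem frozen_confinement_core
    (hc : ∀ k, IsIsolated p (c k).F ∧ Step0 p (c k) (c (k + 1))) (hw : FreeTail.IsWitnessedChain p c j b)
    (hr0 : ∀ e ∈ (c 0).F.support, (c 0).r ≤ e) (hfloor : ∀ k, ordZero (c k).F ≠ p) {k₀ d : ℕ}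
    (hshade : ∀ k, k₀ ≤ k → (c k).shade = (d : ℕ∞))
    {ok : (Fin 4 → Bool) → (Fin 4 → ℕ) → Bool} {h : (Fin 4 → Bool) → (Fin 4 → ℕ) → ℕ} {v : ℕ → ℕ}
    (H : ∀ P, ledgerCheckPermAt p d ok h v P = true)
    (hok : ∀ (P : Fin 4 → Bool) (k₁ : ℕ), k₀ ≤ k₁ → (∀ k, k₁ ≤ k → ∀ z, P z = true → j k ≠ z ∧ b k z = 0) →
      (∀ z, P z = false → ∀ k₂, ∃ k, k₂ ≤ k ∧ (j k = z ∨ b k z ≠ 0)) → ∃ k₂, k₁ ≤ k₂ ∧ ∀ k, k₂ ≤ k → ok P ⇑(c k).r = true) :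
    ∃ (P : Fin 4 → Bool) (i k₂ : ℕ), k₀ ≤ k₂ ∧ (∀ k, k₂ ≤ k → Legal p d ⇑(c k).r ∧ ok P ⇑(c k).r = true ∧ h P ⇑(c k).r = i) ∧
      (∀ k, k₂ ≤ k → ∀ z, P z = true → j k ≠ z ∧ b k z = 0) ∧ (∀ z, P z = false → ∀ k₃, ∃ k, k₃ ≤ k ∧ (j k = z ∨ b k z ≠ 0)) ∧
      v i ≤ p + 3 ∧ v i ≠ 1 ∧ v i ≠ 2 ∧ v i ≠ 4 ∧ ¬ 5 ≤ v i ∧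
      (v i = 3 → ∀ k, k₂ ≤ k → ¬ Lossy ⇑(c k).r ⇑(c (k + 1)).r) := by
  obtain ⟨P, k₁, hk₁, hfrozen, hhit⟩ := exists_frozen_monitor j b k₀
  obtain ⟨k₂, hk₂, hokk⟩ := hok P k₁ hk₁ hfrozen hhit
  -- the walk's edges keep `P` from `k₁`
  have hkeeps : ∀ k, k₁ ≤ k → keepsB P (j k) (fun i => decide (b k i = 0)) = true := by
    intro k hk
    rw [keepsB_eq_true_iff]
    refine ⟨?_, fun z hz => decide_eq_true (hfrozen k hk z hz).2⟩
    by_contra hPj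
    rw [Bool.not_eq_false] at hPj
    exact (hfrozen k hk (j k) hPj).1 rfl
  have hleg : ∀ k, k₀ ≤ k → Legal p d ⇑(c k).r := fun k hk => tail_ledger_legal p hc hw hr0 hfloor hshade hk
  have hchild : ∀ k, k₀ ≤ k → ⇑(c (k + 1)).r = child p d ⇑(c k).r (j k) (fun i => decide (b k i = 0)) :=
    fun k hk => tail_ledger_child p hc hw hr0 hfloor hshade hk
  -- the edge clauses of the certificate along the walk
  have hedge : ∀ k, k₂ ≤ k → h P ⇑(c (k + 1)).r ≤ h P ⇑(c k).r ∧
      (v (h P ⇑(c k).r) = 3 → h P ⇑(c (k + 1)).r = h P ⇑(c k).r → ¬ Lossy ⇑(c k).r ⇑(c (k + 1)).r) ∧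
      (5 ≤ v (h P ⇑(c k).r) → h P ⇑(c (k + 1)).r = h P ⇑(c k).r →
        hitsWB P ⇑(c k).r (v (h P ⇑(c k).r) - 5) (j k) (fun i => decide (b k i = 0)) = false) ∧
      (v (h P ⇑(c k).r) = 2 → h P ⇑(c (k + 1)).r = h P ⇑(c k).r → ∀ (jj' : Fin 4) (S' : Fin 4 → Bool), keepsB P jj' S' = true →
        Legal p d (child p d ⇑(c (k + 1)).r jj' S') → ok P (child p d ⇑(c (k + 1)).r jj' S') = true →
        h P (child p d ⇑(c (k + 1)).r jj' S') = h P ⇑(c k).r → jj' ≠ j k → child p d ⇑(c (k + 1)).r jj' S' (j k) = 0) := by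
    intro k hk
    obtain ⟨-, hE⟩ := sound_of_ledgerCheckPermAt (H P) _ (hleg k (by omega)) (hokk k hk)
    have h1 := hE (j k) (fun i => decide (b k i = 0)) (hkeeps k (by omega))
      (by rw [← hchild k (by omega)]; exact hleg (k + 1) (by omega)) (by rw [← hchild k (by omega)]; exact hokk (k + 1) (by omega))
    rw [← hchild k (by omega)] at h1
    exact h1
  obtain ⟨k₃, hk₃, hlev⟩ := eventually_constant_of_antitone (f := fun k => h P ⇑(c k).r) (k₀ := k₂) fun k hk => (hedge k hk).1
  set i := h P ⇑(c k₃).r with hi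
  obtain ⟨⟨hvle, -, hHV, hFR⟩, -⟩ := sound_of_ledgerCheckPermAt (H P) _ (hleg k₃ (by omega)) (hokk k₃ hk₃)
  refine ⟨P, i, k₃, by omega, fun k hk => ⟨hleg k (by omega), hokk k (by omega), hlev k hk⟩,
    fun k hk z hz => hfrozen k (by omega) z hz, hhit, hvle, fun hv1 => ?_, fun hv2 => ?_, fun hv4 => ?_, fun hv5 => ?_,
    fun hv3 k hk => (hedge k (by omega)).2.1 (by rw [hlev k hk]; exact hv3) (by rw [hlev k hk, hlev (k + 1) (by omega)])⟩
  · -- verdict 1: the dock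
    obtain ⟨k, hk, hlow⟩ := exists_lowerBand_after p hc hw hr0 hfloor hshade (k₂ := k₃) (by omega)
    obtain ⟨⟨-, hLB', -, -⟩, -⟩ := sound_of_ledgerCheckPermAt (H P) _ (hleg k (by omega)) (hokk k (by omega))
    exact hLB' (by rw [hlev k hk]; exact hv1) hlow
  · -- verdict 2: FT
    obtain ⟨k, hk, hsat⟩ := exists_satellite_after p hc hw k₃
    obtain ⟨hjj, hne⟩ := (tail_isSatellite_iff p hc hw hr0 hfloor hshade (k := k) (by omega)).mp hsat
    have hS := (hedge k (by omega)).2.2.2 (by rw [hlev k hk]; exact hv2) (by rw [hlev k hk, hlev (k + 1) (by omega)])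
      (j (k + 1)) (fun i => decide (b (k + 1) i = 0)) (hkeeps (k + 1) (by omega))
    rw [← hchild (k + 1) (by omega)] at hS
    exact hne (hS (hleg (k + 2) (by omega)) (hokk (k + 2) (by omega)) (by rw [hlev k hk, hlev (k + 2) (by omega)]) hjj)
  · -- verdict 4: a heavy frozen set (res-dim4-p-5's ledger theorem)
    have hW := hHV (by rw [← hi]; exact hv4)
    rw [permWeight_eq_sum] at hW
    exact no_tail_of_permanent_weight_ge p hc hw hr0 hfloor hshade (M := k₃) (by omega)
      (P := Finset.univ.filter fun z => P z = true)
      (fun z hz m hm => by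
        rw [Finset.mem_filter] at hz
        exact ⟨(hfrozen m (by omega) z hz.2).1.symm, (hfrozen m (by omega) z hz.2).2⟩) hW
  · -- verdicts 5 + w: a kept-so-far non-frozen letter of weight w is hit inside the level
    obtain ⟨z, hPz, hzw⟩ := (hasFreeWB_eq_true_iff P _ _).mp (hFR (by rw [← hi]; exact hv5))
    classical
    have hex : ∃ k, k₃ ≤ k ∧ (j k = z ∨ b k z ≠ 0) := hhit z hPz k₃
    have hk : k₃ ≤ Nat.find hex ∧ (j (Nat.find hex) = z ∨ b (Nat.find hex) z ≠ 0) := Nat.find_spec hex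
    have hmin : ∀ m, k₃ ≤ m → m < Nat.find hex → j m ≠ z ∧ b m z = 0 := fun m hm hmk => by
      have := Nat.find_min hex hmk
      push Not at this
      exact this hm
    -- the weight of `z` is still `w` at the first hit
    have hconst : ∀ m, k₃ ≤ m → m ≤ Nat.find hex → (c m).r z = (c k₃).r z := by
      intro m hm hmk
      obtain ⟨t, rfl⟩ := Nat.exists_eq_add_of_le hm
      induction t with
      | zero => rfl
      | succ t ih =>
        have hlt : k₃ + t < Nat.find hex := by omega
        rw [← ih (by omega) (by omega), show k₃ + (t + 1) = k₃ + t + 1 by ring]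
        have hc1 := congrFun (hchild (k₃ + t) (by omega)) z
        rw [child_apply_of_ne_decide _ (Ne.symm (hmin _ (by omega) hlt).1), if_pos (hmin _ (by omega) hlt).2] at hc1
        exact hc1
    set k := Nat.find hex
    have hhits := hitsWB_eq_true_of P ⇑(c k).r (v (h P ⇑(c k).r) - 5) (j k) (fun i => decide (b k i = 0)) hPz
      (by rw [hlev k hk.1, hconst k hk.1 le_rfl]; exact hzw) (by
        rcases hk.2 with h | h
        · exact Or.inl h
        · exact Or.inr (by simp [h]))
    rw [(hedge k (by omega)).2.2.1 (by rw [hlev k hk.1]; exact hv5) (by rw [hlev k hk.1, hlev (k + 1) (by omega)])] at hhits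
    exact Bool.false_ne_true hhits

/-- **THE CERTIFICATE SOCKET WITH A FROZEN SET, binary cones** (`d < p`, `e_G ≡ 2`; every prime `p`, every shade `d`).  If
`ledgerCheckPermAt p d ok h v P = true` for every `P` and `ok` is admissible along the tail, then every witnessed isolated above-floor `Step0 p` tail
with `x^{r₀} ∣ F₀`, constant shade `d` and `e_G ≡ 2` from `k₀` has a frozen set `P`, a LIVE level `i` (`v i = 0`) and a time `k₂ ≥ k₀` with: all
later states legal, `ok` and of `h P`-level `i`; every `P`-letter never charted nor translated after `k₂`; every other letter hit beyond every index.
[OURS] [cite: CossartJannsenSaito2020, Thm. 3.14] -/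
theorem tail_confined_of_ledgerCheckPerm
    (hc : ∀ k, IsIsolated p (c k).F ∧ Step0 p (c k) (c (k + 1))) (hw : FreeTail.IsWitnessedChain p c j b)
    (hr0 : ∀ e ∈ (c 0).F.support, (c 0).r ≤ e) (hfloor : ∀ k, ordZero (c k).F ≠ p) {k₀ d : ℕ} (hdp : d < p)
    (hshade : ∀ k, k₀ ≤ k → (c k).shade = (d : ℕ∞)) (he : ∀ k, k₀ ≤ k → Module.finrank K (resVertex (c k)) = 2)
    {ok : (Fin 4 → Bool) → (Fin 4 → ℕ) → Bool} {h : (Fin 4 → Bool) → (Fin 4 → ℕ) → ℕ} {v : ℕ → ℕ}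
    (H : ∀ P, ledgerCheckPermAt p d ok h v P = true)
    (hok : ∀ (P : Fin 4 → Bool) (k₁ : ℕ), k₀ ≤ k₁ → (∀ k, k₁ ≤ k → ∀ z, P z = true → j k ≠ z ∧ b k z = 0) →
      (∀ z, P z = false → ∀ k₂, ∃ k, k₂ ≤ k ∧ (j k = z ∨ b k z ≠ 0)) → ∃ k₂, k₁ ≤ k₂ ∧ ∀ k, k₂ ≤ k → ok P ⇑(c k).r = true) :
    ∃ (P : Fin 4 → Bool) (i k₂ : ℕ), v i = 0 ∧ k₀ ≤ k₂ ∧ (∀ k, k₂ ≤ k → Legal p d ⇑(c k).r ∧ ok P ⇑(c k).r = true ∧ h P ⇑(c k).r = i) ∧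
      (∀ k, k₂ ≤ k → ∀ z, P z = true → j k ≠ z ∧ b k z = 0) ∧ (∀ z, P z = false → ∀ k₃, ∃ k, k₃ ≤ k ∧ (j k = z ∨ b k z ≠ 0)) := by
  obtain ⟨P, i, k₂, hk₂, hlev, hfrozen, hhit, hvle, h1, h2, h4, h5, h3⟩ := frozen_confinement_core p hc hw hr0 hfloor hshade H hok
  refine ⟨P, i, k₂, ?_, hk₂, hlev, hfrozen, hhit⟩
  have h3' : v i ≠ 3 := fun hv3 => by
    obtain ⟨k, hk, hlossy⟩ := exists_lossy_after p hc hw hr0 hfloor hdp hshade he (k₂ := k₂) hk₂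
    exact h3 hv3 k hk hlossy
  omega

/-- **THE CERTIFICATE SOCKET WITH A FROZEN SET, any polar rank** (every prime `p`, every shade `d`; serves the power cones `e_G = 3`): the same
conclusion for certificates using no verdict `3`. [OURS] [cite: CossartJannsenSaito2020, Thm. 3.14] -/
theorem tail_confined_of_ledgerCheckPerm'
    (hc : ∀ k, IsIsolated p (c k).F ∧ Step0 p (c k) (c (k + 1))) (hw : FreeTail.IsWitnessedChain p c j b)
    (hr0 : ∀ e ∈ (c 0).F.support, (c 0).r ≤ e) (hfloor : ∀ k, ordZero (c k).F ≠ p) {k₀ d : ℕ}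
    (hshade : ∀ k, k₀ ≤ k → (c k).shade = (d : ℕ∞))
    {ok : (Fin 4 → Bool) → (Fin 4 → ℕ) → Bool} {h : (Fin 4 → Bool) → (Fin 4 → ℕ) → ℕ} {v : ℕ → ℕ}
    (H : ∀ P, ledgerCheckPermAt p d ok h v P = true) (hv3 : ∀ i, v i ≠ 3)
    (hok : ∀ (P : Fin 4 → Bool) (k₁ : ℕ), k₀ ≤ k₁ → (∀ k, k₁ ≤ k → ∀ z, P z = true → j k ≠ z ∧ b k z = 0) →
      (∀ z, P z = false → ∀ k₂, ∃ k, k₂ ≤ k ∧ (j k = z ∨ b k z ≠ 0)) → ∃ k₂, k₁ ≤ k₂ ∧ ∀ k, k₂ ≤ k → ok P ⇑(c k).r = true) :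
    ∃ (P : Fin 4 → Bool) (i k₂ : ℕ), v i = 0 ∧ k₀ ≤ k₂ ∧ (∀ k, k₂ ≤ k → Legal p d ⇑(c k).r ∧ ok P ⇑(c k).r = true ∧ h P ⇑(c k).r = i) ∧
      (∀ k, k₂ ≤ k → ∀ z, P z = true → j k ≠ z ∧ b k z = 0) ∧ (∀ z, P z = false → ∀ k₃, ∃ k, k₃ ≤ k ∧ (j k = z ∨ b k z ≠ 0)) := by
  obtain ⟨P, i, k₂, hk₂, hlev, hfrozen, hhit, hvle, h1, h2, h4, h5, -⟩ := frozen_confinement_core p hc hw hr0 hfloor hshade H hok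
  have h3 := hv3 i
  exact ⟨P, i, k₂, by omega, hk₂, hlev, hfrozen, hhit⟩

end Chain

end ResCone

end Summit.ResolutionOfSingularities.ResolutionOfSingularities.Theorems.PIDim4

end
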